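import Literature.AlgebraicGeometry.GroupSchemes.IdealKernelLayerMap
import Literature.AlgebraicGeometry.GroupSchemes.GroupSchemeKernelAlg
import Literature.AlgebraicGeometry.GroupSchemes.FlatClosedSubgroupOfGenericFibre
import Literature.AlgebraicGeometry.GroupSchemes.UnitComponentRank
import Mathlib.RingTheory.Flat.TorsionFree
import HarnessLib

/-!
# The kernel of the ideal-kernel layer map, and its flatness ([Tate 1997] (1.6)–(1.7), (3.7); [EGA IV₂] 2.8.5; [GW I] Def. 4.45 (2))

Topic `Literature/AlgebraicGeometry/GroupSchemes`; namespace `Literature.AlgebraicGeometry.GroupSchemes.LayerMapKernel`.  THEOREMS ONLY (no definition,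
no instance, no notation, no named fact, no `sorry`).  Cell `hodgecm-mathlib` (D-0151), programme P6 «MOD» (crux hLiu418 = stmt-HodgeConjecture-24832,
`--supports`, count-neutral): organ **(F-ker) «KERNEL OF THE LAYER MAP»** of the FLATNESS-INPUT road of line L2 ∕ socket `stub_DOWN` (LEAD F0P6-plan (g3) LDEAL v1
§L2 T2 ask; LA2-p04 (g0)).  It discharges STRUCTURALLY the one instance hypothesis `[Module.Flat R (Γ(G₁) ⧸ J(φ))]` of ★ (O-K) ED. 2
`AffineGroupScheme.spI_map_ker_counit_pullback_eq` («the kernel of the special fibre IS the specialisation of the generic kernel») when `φ` is the LAYER MAP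
(★ `IdealKernelLayerMap`) of a homomorphism `ψ : A → B` whose kernel is a flat closed subgroup of the layer `A[𝔭]` — the situation of (O1) `stub_SPEC`:
`ψ = q` the quotient isogeny by the flat closure `H_L ≤ A_y[𝔭_{c•w}]` of a line, or `ψ = q ≫ d` with `d` an isomorphism on the `c•w`-layers.  Companion of ★
B-p08 `KernelIdealFlatQuotient` (the fibre-RANK door to the same instance).  HC_CM is proved only modulo the printed citations until rung 0 closes; this file
is generic and changes no count.

THE MATHEMATICS ([Tate1997FiniteFlatGroupSchemes] (1.6)–(1.7): kernels of homomorphisms of group functors are computed on `T`-points; (3.7): over a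
valuation ring the flat closed subgroups of `G` correspond to the closed subgroups of the generic fibre; [EGAIV2] Prop. 2.8.5; [GortzWedhorn2020] Definition 4.45 (2):
`Ker f = G ×_{H,e} S`).  In a cartesian monoidal category let `ιA : GA ↪ A`, `ιB : GB ↪ B` be monomorphisms (the pins `A[𝔭] ↪ A`, `B[𝔭] ↪ B`), `ψ : A → B`,
and `φ : GA → GB` a morphism OVER `ψ`: `φ ≫ ιB = ιA ≫ ψ` (the layer map, ★ `IdealKernelLayerMap.exists_layerMap`).  Then on `T`-points
`Ker φ (T) = {t ∈ GA(T) ∣ ιA t ∈ Ker ψ (T)}` (★ L4), i.e. `Ker φ = Ker ψ ×_A GA`: there is a canonical monomorphism `κ : Ker φ → Ker ψ` over `ιA`, a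
homomorphism, and `κ` is an ISOMORPHISM as soon as `Ker ψ ≤ GA` (every `ψ`-killed point factors through `ιA`; e.g. `Ker ψ` is killed by `𝔭`).  Kernels do not see
post-composition with a monomorphic homomorphism, so the same holds for `ψ = q ≫ d` when the layer map of `d` is a monomorphism (★ L5 functoriality); and an
element `a` invertible modulo `𝔭` acts invertibly on the layer (`β a ≫ β b = β (ab + p) = 𝟙`).  Consequently, over a base scheme `Ker φ → S` is flat (finite)
when `Ker ψ → S` is, and over `Spec R` with affine carriers `Γ(GA) ⧸ J(φ) ≅ Γ(Ker φ) ≅ Γ(Ker ψ)` is `R`-flat — the (O-K) ED. 2 instance.  Finally, over a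
valuation ring (any Bézout domain) the schematic IMAGE of a flat source is flat: `Γ(G₂) ⧸ ker Γ(φ) ↪ Γ(G₁)` is torsion-free ([StacksProject] Tag 0539) — the
flatness the image line needs for ★ EGA IV₂ 2.8.5 uniqueness (`FlatClosedSubgroupOfGenericFibre`, `IdealClosureGenericFibre`).

## Contents
* §1 (any cartesian monoidal `C`) `exists_kerIso_of_comp_mono` (`Ker (φ ≫ m) ≅ Ker φ`), `exists_comp_kerι_eq_iff` (points of `Ker φ` = points of `GA` killed by
  `ιA ≫ ψ`), **`exists_kerHom`** (`κ : Ker φ → Ker ψ`, `κ ≫ ι_ψ = ι_φ ≫ ιA`), `kerHom_unique`, `mono_kerHom`, `isMonHom_kerHom`, **`exists_kerIso_of_factors`** ∕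
  **`exists_kerIso_of_pin`** (`Ker φ ≅ Ker ψ` when `Ker ψ ≤ A[𝔭]`), **`exists_kerIso_of_comp`** (`ψ = q ≫ d`, layer map of `d` mono), `isIso_of_isIso_comp_comp`,
  **`isIso_layerAction_of_mul_add_eq_one`** (a unit mod `𝔭` acts invertibly on `A[𝔭]`).
* §2 (`Over S`) `flat_hom_of_iso`, `isFinite_hom_of_iso`, **`flat_ker_hom_of_pin`**, `isFinite_ker_hom_of_pin`.
* §3 (`Over (Spec R)`, affine) `flat_alg_ker`, **`flat_quotient_map_ker_counit_of_flat_ker`** (`Flat (Ker φ → Spec R) ⇒ Module.Flat R (Γ(G₁) ⧸ J(φ))`), HEADS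
  **`flat_quotient_map_ker_counit_of_pin`** and **`flat_quotient_map_ker_counit_of_pin_comp`** — the ★ (O-K) ED. 2 instance for the layer map of `ψ` (resp. `q ≫ d`).
* §4 (Bézout ∕ valuation ring) `flat_quotient_ker_of_flat_target`, **`flat_quotient_ker_comap_of_flat`** — the schematic image of a flat source is flat.

## References
* [Tate1997FiniteFlatGroupSchemes] J. Tate, *Finite flat group schemes*, in: Modular Forms and Fermat՚s Last Theorem (1997), (1.6)–(1.7) p. 122, (3.7) p. 146.
* [GortzWedhorn2020] U. Görtz, T. Wedhorn, *Algebraic Geometry I: Schemes*, 2nd ed. (2020), Definition 4.45 (2) p. 117; Prop. 14.14.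
* [EGAIV2] A. Grothendieck, J. Dieudonné, *ÉGA* IV₂, Publ. Math. IHÉS 24 (1965), Prop. 2.8.5.
* [StacksProject] The Stacks Project, Tag 0539 (flat ⟺ torsion-free over a valuation ring ∕ Bézout domain).
* [Waterhouse1979] W. C. Waterhouse, *Introduction to Affine Group Schemes*, GTM 66 (1979), §2.1 p. 14.
-/

set_option autoImplicit false

-- Mathlib's `Over`/`Scheme` APIs are stated across semireducible wrappers (as in the ★ `GroupSchemes/*` files).
set_option backward.isDefEq.respectTransparency false

universe u

open CategoryTheory CategoryTheory.Limits MonoidalCategory CartesianMonoidalCategory AlgebraicGeometry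

noncomputable section

namespace Literature.AlgebraicGeometry.GroupSchemes.LayerMapKernel

open scoped MonObj

open GroupSchemeKernel IdealKernelLayerMap

/-! ## §1 The kernel of the layer map in a cartesian monoidal category -/

section Generic

variable {C : Type*} [Category C] [CartesianMonoidalCategory C]

/-- **KERNELS DO NOT SEE POST-COMPOSITION WITH A MONOMORPHIC HOMOMORPHISM**: `Ker (φ ≫ m) ≅ Ker φ` over `G`, since `t ≫ φ ≫ m = 1 ↔ t ≫ φ = 1`
(`m` mono, `1 ≫ m = 1`). [cite: GortzWedhorn2020, Definition 4.45 (2), p. 117] [cite: Tate1997FiniteFlatGroupSchemes, (1.6)–(1.7) p. 122] -/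
theorem exists_kerIso_of_comp_mono {G H K : C} [GrpObj H] [GrpObj K] (φ : G ⟶ H) (m : H ⟶ K) [IsMonHom m] [Mono m]
    [HasPullback φ η[H]] [HasPullback (φ ≫ m) η[K]] :
    ∃ e : ker (φ ≫ m) ≅ ker φ, e.hom ≫ kerι φ = kerι (φ ≫ m) ∧ e.inv ≫ kerι (φ ≫ m) = kerι φ := by
  have h1 : kerι (φ ≫ m) ≫ φ = 1 := by
    rw [← cancel_mono m, Category.assoc, kerι_comp, MonObj.one_comp]
  have h2 : kerι φ ≫ φ ≫ m = 1 := by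
    rw [← Category.assoc, kerι_comp, MonObj.one_comp]
  refine ⟨⟨kerLift (kerι (φ ≫ m)) h1, kerLift (kerι φ) h2, ?_, ?_⟩, kerLift_ι _ h1, kerLift_ι _ h2⟩
  · exact ker_hom_ext (by rw [Category.assoc, kerLift_ι, kerLift_ι, Category.id_comp])
  · exact ker_hom_ext (by rw [Category.assoc, kerLift_ι, kerLift_ι, Category.id_comp])

/-- **`T`-POINTS OF THE KERNEL OF THE LAYER MAP**: for `φ` over `ψ` (`φ ≫ ιB = ιA ≫ ψ`, `ιB` a mono homomorphism), a point `t` of `GA` factors through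
`Ker φ` iff `ιA t` is killed by `ψ` (★ L4 `comp_eq_one_iff_of_comp_eq` + the universal property of `Ker φ`): `Ker φ = Ker ψ ×_A GA` on points.
[cite: Tate1997FiniteFlatGroupSchemes, (1.6)–(1.7) p. 122] [cite: GortzWedhorn2020, Definition 4.45 (2), p. 117] -/
theorem exists_comp_kerι_eq_iff {A B GA GB : C} [GrpObj B] [GrpObj GB] (ιA : GA ⟶ A) (ιB : GB ⟶ B) [IsMonHom ιB] [Mono ιB]
    (ψ : A ⟶ B) {φ : GA ⟶ GB} (hφ : φ ≫ ιB = ιA ≫ ψ) [HasPullback φ η[GB]] {T : C} (t : T ⟶ GA) :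
    (∃ s : T ⟶ ker φ, s ≫ kerι φ = t) ↔ (t ≫ ιA) ≫ ψ = 1 := by
  rw [Category.assoc, ← comp_eq_one_iff_of_comp_eq ιA ιB ψ hφ t]
  constructor
  · rintro ⟨s, rfl⟩
    rw [Category.assoc, kerι_comp, MonObj.comp_one]
  · intro h
    exact ⟨kerLift t h, kerLift_ι _ _⟩

/-- **THE CANONICAL MAP `κ : Ker φ → Ker ψ` OVER `ιA`** (`κ ≫ ι_ψ = ι_φ ≫ ιA`): `ι_φ ≫ ιA` is killed by `ψ`. [cite: Tate1997FiniteFlatGroupSchemes, (1.6)–(1.7) p. 122]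
[cite: GortzWedhorn2020, Definition 4.45 (2), p. 117] -/
theorem exists_kerHom {A B GA GB : C} [GrpObj B] [GrpObj GB] (ιA : GA ⟶ A) (ιB : GB ⟶ B) [IsMonHom ιB] [Mono ιB]
    (ψ : A ⟶ B) {φ : GA ⟶ GB} (hφ : φ ≫ ιB = ιA ≫ ψ) [HasPullback φ η[GB]] [HasPullback ψ η[B]] :
    ∃ κ : ker φ ⟶ ker ψ, κ ≫ kerι ψ = kerι φ ≫ ιA := by
  have h : (kerι φ ≫ ιA) ≫ ψ = 1 := (exists_comp_kerι_eq_iff ιA ιB ψ hφ (kerι φ)).mp ⟨𝟙 _, Category.id_comp _⟩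
  exact ⟨kerLift (kerι φ ≫ ιA) h, kerLift_ι _ _⟩

/-- `κ` is unique over `ιA` (`ι_ψ` is a monomorphism). [cite: GortzWedhorn2020, Definition 4.45 (2), p. 117] -/
theorem kerHom_unique {A B GA GB : C} [GrpObj B] [GrpObj GB] (ιA : GA ⟶ A) (ψ : A ⟶ B) (φ : GA ⟶ GB) [HasPullback φ η[GB]] [HasPullback ψ η[B]]
    {κ₁ κ₂ : ker φ ⟶ ker ψ} (h₁ : κ₁ ≫ kerι ψ = kerι φ ≫ ιA) (h₂ : κ₂ ≫ kerι ψ = kerι φ ≫ ιA) : κ₁ = κ₂ :=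
  ker_hom_ext (h₁.trans h₂.symm)

/-- `κ` is a monomorphism when `ιA` is. [cite: GortzWedhorn2020, Definition 4.45 (2), p. 117] -/
theorem mono_kerHom {A B GA GB : C} [GrpObj B] [GrpObj GB] (ιA : GA ⟶ A) [Mono ιA] (ψ : A ⟶ B) (φ : GA ⟶ GB) [HasPullback φ η[GB]] [HasPullback ψ η[B]]
    {κ : ker φ ⟶ ker ψ} (hκ : κ ≫ kerι ψ = kerι φ ≫ ιA) : Mono κ := by
  haveI := mono_kerι φ
  haveI : Mono (κ ≫ kerι ψ) := by rw [hκ]; exact mono_comp _ _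
  exact mono_of_mono κ (kerι ψ)

/-- `κ` is a homomorphism when `ιA`, `ψ`, `φ` are (its composite with the mono homomorphism `ι_ψ` is the homomorphism `ι_φ ≫ ιA`; ★ `AffineGroupScheme.isMonHom_of_comp_mono`).
[cite: Tate1997FiniteFlatGroupSchemes, (1.6)–(1.7) p. 122] -/
theorem isMonHom_kerHom {A B GA GB : C} [GrpObj A] [GrpObj B] [GrpObj GA] [GrpObj GB] (ιA : GA ⟶ A) [IsMonHom ιA] (ψ : A ⟶ B) [IsMonHom ψ]
    (φ : GA ⟶ GB) [IsMonHom φ] [HasPullback φ η[GB]] [HasPullback ψ η[B]]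
    {κ : ker φ ⟶ ker ψ} (hκ : κ ≫ kerι ψ = kerι φ ≫ ιA) : IsMonHom κ := by
  haveI := mono_kerι ψ
  haveI : IsMonHom (κ ≫ kerι ψ) := by rw [hκ]; infer_instance
  exact AffineGroupScheme.isMonHom_of_comp_mono κ (kerι ψ)

/-- **`Ker φ ≅ Ker ψ` WHEN `Ker ψ ≤ GA`**: if every `ψ`-killed point of `A` factors through the mono `ιA`, the canonical `κ` is an isomorphism; the inverse is the
lift of `Ker ψ ↪ A` through `ιA` and then through `Ker φ` (★ L4). [cite: Tate1997FiniteFlatGroupSchemes, (1.6)–(1.7) p. 122] [cite: GortzWedhorn2020, Definition 4.45 (2), p. 117] -/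
theorem exists_kerIso_of_factors {A B GA GB : C} [GrpObj B] [GrpObj GB] (ιA : GA ⟶ A) [Mono ιA] (ιB : GB ⟶ B) [IsMonHom ιB] [Mono ιB]
    (ψ : A ⟶ B) {φ : GA ⟶ GB} (hφ : φ ≫ ιB = ιA ≫ ψ) [HasPullback φ η[GB]] [HasPullback ψ η[B]]
    (hle : ∀ ⦃T : C⦄ (t : T ⟶ A), t ≫ ψ = 1 → ∃ s : T ⟶ GA, s ≫ ιA = t) :
    ∃ e : ker φ ≅ ker ψ, e.hom ≫ kerι ψ = kerι φ ≫ ιA ∧ e.inv ≫ kerι φ ≫ ιA = kerι ψ := by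
  obtain ⟨κ, hκ⟩ := exists_kerHom ιA ιB ψ hφ
  obtain ⟨j, hj⟩ := hle (kerι ψ) (kerι_comp ψ)
  have hjφ : j ≫ φ = 1 := by
    rw [comp_eq_one_iff_of_comp_eq ιA ιB ψ hφ j, ← Category.assoc, hj, kerι_comp]
  refine ⟨⟨κ, kerLift j hjφ, ?_, ?_⟩, hκ, ?_⟩
  · apply ker_hom_ext
    rw [Category.assoc, kerLift_ι, Category.id_comp, ← cancel_mono ιA, Category.assoc, hj, hκ]
  · apply ker_hom_ext
    rw [Category.assoc, hκ, ← Category.assoc, kerLift_ι, hj, Category.id_comp]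
  · show kerLift j hjφ ≫ kerι φ ≫ ιA = kerι ψ
    rw [← Category.assoc, kerLift_ι, hj]

/-- **`Ker φ ≅ Ker ψ` IN PIN CURRENCY**: with the kernel-of-`𝔭` universal property of `ιA` (`hkerA`, the dock՚s `hkerG₀` shape) and `Ker ψ` killed by `𝔭`
(`∀ t, t ≫ ψ = 1 → ∀ a ∈ 𝔭, t ≫ α a = 1` — e.g. `ψ` the quotient by a closed subgroup of `A[𝔭]`), the kernel of the layer map IS the kernel of `ψ`.
[cite: Tate1997FiniteFlatGroupSchemes, (1.6)–(1.7) p. 122, (3.7) p. 146] [cite: GortzWedhorn2020, Definition 4.45 (2), p. 117] -/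
theorem exists_kerIso_of_pin {A B GA GB : C} [MonObj A] [GrpObj B] [GrpObj GB] {O : Type*} {σ : Type*} [SetLike σ O] (𝔭 : σ) (α : O → (A ⟶ A))
    (ιA : GA ⟶ A) [Mono ιA] (ιB : GB ⟶ B) [IsMonHom ιB] [Mono ιB]
    (hkerA : ∀ ⦃T : C⦄ (t : T ⟶ A), (∀ a ∈ 𝔭, t ≫ α a = 1) ↔ ∃ s : T ⟶ GA, s ≫ ιA = t)
    (ψ : A ⟶ B) {φ : GA ⟶ GB} (hφ : φ ≫ ιB = ιA ≫ ψ) [HasPullback φ η[GB]] [HasPullback ψ η[B]]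
    (hψ : ∀ ⦃T : C⦄ (t : T ⟶ A), t ≫ ψ = 1 → ∀ a ∈ 𝔭, t ≫ α a = 1) :
    ∃ e : ker φ ≅ ker ψ, e.hom ≫ kerι ψ = kerι φ ≫ ιA ∧ e.inv ≫ kerι φ ≫ ιA = kerι ψ :=
  exists_kerIso_of_factors ιA ιB ψ hφ fun _ t ht => (hkerA t).mp (hψ t ht)

/-- **COMPOSITES: `Ker φ ≅ Ker φ_q` FOR `ψ = q ≫ d` WHEN THE LAYER MAP OF `d` IS A MONOMORPHISM** (a homomorphism): the layer map `φ` of `q ≫ d` over the pins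
is `φ_q ≫ φ_d` (★ L1 uniqueness + ★ L5 `comp_comp_eq`), and kernels do not see `φ_d` (`exists_kerIso_of_comp_mono`).  In the application `d` is a
`c•w`-unit isogeny, an isomorphism on the `c•w`-layers. [cite: Tate1997FiniteFlatGroupSchemes, (1.6)–(1.7) p. 122] [cite: GortzWedhorn2020, Definition 4.45 (2), p. 117] -/
theorem exists_kerIso_of_comp {A B D GA GB GD : C} [GrpObj GB] [GrpObj GD] (ιA : GA ⟶ A) (ιB : GB ⟶ B) (ιD : GD ⟶ D) [Mono ιD]
    (q : A ⟶ B) (d : B ⟶ D) {φq : GA ⟶ GB} (hq : φq ≫ ιB = ιA ≫ q) {φd : GB ⟶ GD} (hd : φd ≫ ιD = ιB ≫ d) [IsMonHom φd] [Mono φd]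
    {φ : GA ⟶ GD} (hφ : φ ≫ ιD = ιA ≫ q ≫ d) [HasPullback φ η[GD]] [HasPullback φq η[GB]] :
    ∃ e : ker φ ≅ ker φq, e.hom ≫ kerι φq = kerι φ ∧ e.inv ≫ kerι φ = kerι φq := by
  have heq : φ = φq ≫ φd := eq_of_comp_eq_of_comp_eq ιA ιD (q ≫ d) hφ (comp_comp_eq ιA ιB ιD hq hd)
  subst heq
  exact exists_kerIso_of_comp_mono φq φd

omit [CartesianMonoidalCategory C] in
/-- `f` is an isomorphism if `f ≫ g` and `g ≫ f` are (split mono + split epi). [cite: GortzWedhorn2020, Definition 4.45 (2), p. 117] -/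
theorem isIso_of_isIso_comp_comp {X Y : C} (f : X ⟶ Y) (g : Y ⟶ X) [IsIso (f ≫ g)] [IsIso (g ≫ f)] : IsIso f := by
  haveI : IsSplitMono f := IsSplitMono.mk' ⟨g ≫ inv (f ≫ g), by rw [← Category.assoc, IsIso.hom_inv_id]⟩
  haveI : IsSplitEpi f := IsSplitEpi.mk' ⟨inv (g ≫ f) ≫ g, by rw [Category.assoc, IsIso.inv_hom_id]⟩
  exact isIso_of_mono_of_isSplitEpi f

/-- The layer action is killed by `𝔭`: `βA p = 1` for `p ∈ 𝔭` (`βA p ≫ ιA = ιA ≫ α p = 1 = 1 ≫ ιA`, ★ `comp_eq_one_of_pin`, `ιA` a mono homomorphism).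
[cite: Tate1997FiniteFlatGroupSchemes, (1.6)–(1.7) p. 122] -/
theorem layerAction_eq_one_of_mem {A GA : C} [MonObj A] [MonObj GA] {O : Type*} {σ : Type*} [SetLike σ O] (𝔭 : σ) (α : O → (A ⟶ A))
    (ιA : GA ⟶ A) [IsMonHom ιA] [Mono ιA]
    (hkerA : ∀ ⦃T : C⦄ (t : T ⟶ A), (∀ a ∈ 𝔭, t ≫ α a = 1) ↔ ∃ s : T ⟶ GA, s ≫ ιA = t)
    (βA : O → (GA ⟶ GA)) (hβA : ∀ a, βA a ≫ ιA = ιA ≫ α a) {p : O} (hp : p ∈ 𝔭) : βA p = 1 := by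
  rw [← cancel_mono ιA, hβA, comp_eq_one_of_pin 𝔭 α ιA hkerA hp, MonObj.one_comp]

omit [CartesianMonoidalCategory C] in
/-- The layer action is multiplicative: `βA (a * b) = βA b ≫ βA a` when `α (a * b) = α b ≫ α a` (the ★ `RingAction.i_mul` convention).
[cite: Tate1997FiniteFlatGroupSchemes, (1.6)–(1.7) p. 122] -/
theorem layerAction_mul {A GA : C} {O : Type*} [Mul O] (α : O → (A ⟶ A)) (αmul : ∀ a b, α (a * b) = α b ≫ α a)
    (ιA : GA ⟶ A) [Mono ιA] (βA : O → (GA ⟶ GA)) (hβA : ∀ a, βA a ≫ ιA = ιA ≫ α a) (a b : O) :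
    βA (a * b) = βA b ≫ βA a := by
  rw [← cancel_mono ιA]
  calc βA (a * b) ≫ ιA = ιA ≫ α (a * b) := hβA _
    _ = ιA ≫ α b ≫ α a := by rw [αmul]
    _ = (βA b ≫ ιA) ≫ α a := by rw [hβA b, Category.assoc]
    _ = βA b ≫ βA a ≫ ιA := by rw [Category.assoc, hβA a]
    _ = (βA b ≫ βA a) ≫ ιA := (Category.assoc _ _ _).symm

/-- The layer action is additive: `βA (a + b) = βA a * βA b` in the group `Hom(GA, GA)` when `α (a + b) = α a * α b` (the ★ `RingAction.i_add` convention;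
`ιA` a homomorphism). [cite: Tate1997FiniteFlatGroupSchemes, (1.6)–(1.7) p. 122] -/
theorem layerAction_add {A GA : C} [MonObj A] [MonObj GA] {O : Type*} [Add O] (α : O → (A ⟶ A)) (αadd : ∀ a b, α (a + b) = α a * α b)
    (ιA : GA ⟶ A) [IsMonHom ιA] [Mono ιA] (βA : O → (GA ⟶ GA)) (hβA : ∀ a, βA a ≫ ιA = ιA ≫ α a) (a b : O) :
    βA (a + b) = βA a * βA b := by
  rw [← cancel_mono ιA, hβA, αadd, MonObj.comp_mul, MonObj.mul_comp, hβA, hβA]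

omit [CartesianMonoidalCategory C] in
/-- The layer action is unital: `βA 1 = 𝟙` when `α 1 = 𝟙`. [cite: Tate1997FiniteFlatGroupSchemes, (1.6)–(1.7) p. 122] -/
theorem layerAction_one {A GA : C} {O : Type*} [One O] (α : O → (A ⟶ A)) (α1 : α 1 = 𝟙 A)
    (ιA : GA ⟶ A) [Mono ιA] (βA : O → (GA ⟶ GA)) (hβA : ∀ a, βA a ≫ ιA = ιA ≫ α a) : βA 1 = 𝟙 GA := by
  rw [← cancel_mono ιA, hβA, α1, Category.comp_id, Category.id_comp]

/-- **A UNIT MODULO `𝔭` ACTS INVERTIBLY ON THE LAYER `A[𝔭]`**: if `a * b + p = 1` with `p ∈ 𝔭`, then `βA a` is an isomorphism of `GA` with inverse `βA b`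
(`βA b ≫ βA a = βA (ab) * βA p = βA (ab + p) = βA 1 = 𝟙`).  So a `𝔭`-unit isogeny `d` (`c ≫ d = ι(a)`) is an isomorphism on the `𝔭`-layers once the other
composite is (`isIso_of_isIso_comp_comp`). [cite: Tate1997FiniteFlatGroupSchemes, (1.6)–(1.7) p. 122, (3.7) p. 146] -/
theorem isIso_layerAction_of_mul_add_eq_one {A GA : C} [MonObj A] [MonObj GA] {O : Type*} [CommSemiring O] {σ : Type*} [SetLike σ O] (𝔭 : σ)
    (α : O → (A ⟶ A)) (α1 : α 1 = 𝟙 A) (αmul : ∀ a b, α (a * b) = α b ≫ α a) (αadd : ∀ a b, α (a + b) = α a * α b)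
    (ιA : GA ⟶ A) [IsMonHom ιA] [Mono ιA]
    (hkerA : ∀ ⦃T : C⦄ (t : T ⟶ A), (∀ a ∈ 𝔭, t ≫ α a = 1) ↔ ∃ s : T ⟶ GA, s ≫ ιA = t)
    (βA : O → (GA ⟶ GA)) (hβA : ∀ a, βA a ≫ ιA = ιA ≫ α a) {a b p : O} (hab : a * b + p = 1) (hp : p ∈ 𝔭) :
    IsIso (βA a) := by
  have hp1 : βA p = 1 := layerAction_eq_one_of_mem 𝔭 α ιA hkerA βA hβA hp
  have h1 : βA b ≫ βA a = 𝟙 GA := by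
    rw [← layerAction_mul α αmul ιA βA hβA, ← mul_one (βA (a * b)), ← hp1, ← layerAction_add α αadd ιA βA hβA, hab,
      layerAction_one α α1 ιA βA hβA]
  have h2 : βA a ≫ βA b = 𝟙 GA := by
    rw [← layerAction_mul α αmul ιA βA hβA, mul_comm, ← mul_one (βA (a * b)), ← hp1, ← layerAction_add α αadd ιA βA hβA, hab,
      layerAction_one α α1 ιA βA hβA]
  exact ⟨βA b, h2, h1⟩

end Generic

/-! ## §2 Over a base scheme: `Ker φ → S` is flat (finite) when `Ker ψ → S` is -/

section OverScheme

variable {S : Scheme.{u}}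

/-- `Flat` is transported along an isomorphism of `S`-schemes (`X.hom = e.hom.left ≫ Y.hom`). [cite: GortzWedhorn2020, Prop. 14.14] -/
theorem flat_hom_of_iso {X Y : Over S} (e : X ≅ Y) [Flat Y.hom] : Flat X.hom := by
  rw [← Over.w e.hom]
  haveI : IsIso e.hom.left := ((Over.forget S).mapIso e).isIso_hom
  infer_instance

/-- `IsFinite` is transported along an isomorphism of `S`-schemes. [cite: GortzWedhorn2020, Prop. 14.14] -/
theorem isFinite_hom_of_iso {X Y : Over S} (e : X ≅ Y) [IsFinite Y.hom] : IsFinite X.hom := by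
  rw [← Over.w e.hom]
  haveI : IsIso e.hom.left := ((Over.forget S).mapIso e).isIso_hom
  infer_instance

/-- `IsAffine` is transported along an isomorphism of `S`-schemes. [cite: GortzWedhorn2020, Prop. 14.14] -/
theorem isAffine_left_of_iso {X Y : Over S} (e : X ≅ Y) [IsAffine Y.left] : IsAffine X.left :=
  haveI : IsIso e.hom.left := ((Over.forget S).mapIso e).isIso_hom
  IsAffine.of_isIso e.hom.left

/-- **`Ker φ → S` IS FLAT when `Ker ψ → S` is and `Ker ψ ≤ A[𝔭]`** (pin currency; `Ker φ ≅ Ker ψ` by `exists_kerIso_of_pin`).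
[cite: Tate1997FiniteFlatGroupSchemes, (3.7) p. 146] [cite: EGAIV2, Prop. 2.8.5] -/
theorem flat_ker_hom_of_pin {A B GA GB : Over S} [MonObj A] [GrpObj B] [GrpObj GB] {O : Type*} {σ : Type*} [SetLike σ O] (𝔭 : σ) (α : O → (A ⟶ A))
    (ιA : GA ⟶ A) [Mono ιA] (ιB : GB ⟶ B) [IsMonHom ιB] [Mono ιB]
    (hkerA : ∀ ⦃T : Over S⦄ (t : T ⟶ A), (∀ a ∈ 𝔭, t ≫ α a = 1) ↔ ∃ s : T ⟶ GA, s ≫ ιA = t)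
    (ψ : A ⟶ B) {φ : GA ⟶ GB} (hφ : φ ≫ ιB = ιA ≫ ψ)
    (hψ : ∀ ⦃T : Over S⦄ (t : T ⟶ A), t ≫ ψ = 1 → ∀ a ∈ 𝔭, t ≫ α a = 1) [Flat (ker ψ).hom] :
    Flat (ker φ).hom := by
  obtain ⟨e, -, -⟩ := exists_kerIso_of_pin 𝔭 α ιA ιB hkerA ψ hφ hψ
  exact flat_hom_of_iso e

/-- **`Ker φ → S` IS FINITE when `Ker ψ → S` is and `Ker ψ ≤ A[𝔭]`.** [cite: Tate1997FiniteFlatGroupSchemes, (3.7) p. 146] -/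
theorem isFinite_ker_hom_of_pin {A B GA GB : Over S} [MonObj A] [GrpObj B] [GrpObj GB] {O : Type*} {σ : Type*} [SetLike σ O] (𝔭 : σ) (α : O → (A ⟶ A))
    (ιA : GA ⟶ A) [Mono ιA] (ιB : GB ⟶ B) [IsMonHom ιB] [Mono ιB]
    (hkerA : ∀ ⦃T : Over S⦄ (t : T ⟶ A), (∀ a ∈ 𝔭, t ≫ α a = 1) ↔ ∃ s : T ⟶ GA, s ≫ ιA = t)
    (ψ : A ⟶ B) {φ : GA ⟶ GB} (hφ : φ ≫ ιB = ιA ≫ ψ)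
    (hψ : ∀ ⦃T : Over S⦄ (t : T ⟶ A), t ≫ ψ = 1 → ∀ a ∈ 𝔭, t ≫ α a = 1) [IsFinite (ker ψ).hom] :
    IsFinite (ker φ).hom := by
  obtain ⟨e, -, -⟩ := exists_kerIso_of_pin 𝔭 α ιA ιB hkerA ψ hφ hψ
  exact isFinite_hom_of_iso e

/-- **Composites**: `Ker φ → S` is flat for the layer map `φ` of `q ≫ d` when `Ker q → S` is flat, `Ker q ≤ A[𝔭]`, and the layer map of `d` is a monomorphic
homomorphism. [cite: Tate1997FiniteFlatGroupSchemes, (3.7) p. 146] [cite: EGAIV2, Prop. 2.8.5] -/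
theorem flat_ker_hom_of_pin_comp {A B D GA GB GD : Over S} [MonObj A] [GrpObj B] [GrpObj GB] [GrpObj GD] {O : Type*} {σ : Type*} [SetLike σ O] (𝔭 : σ)
    (α : O → (A ⟶ A)) (ιA : GA ⟶ A) [Mono ιA] (ιB : GB ⟶ B) [IsMonHom ιB] [Mono ιB] (ιD : GD ⟶ D) [Mono ιD]
    (hkerA : ∀ ⦃T : Over S⦄ (t : T ⟶ A), (∀ a ∈ 𝔭, t ≫ α a = 1) ↔ ∃ s : T ⟶ GA, s ≫ ιA = t)
    (q : A ⟶ B) (d : B ⟶ D) {φq : GA ⟶ GB} (hq : φq ≫ ιB = ιA ≫ q) {φd : GB ⟶ GD} (hd : φd ≫ ιD = ιB ≫ d) [IsMonHom φd] [Mono φd]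
    {φ : GA ⟶ GD} (hφ : φ ≫ ιD = ιA ≫ q ≫ d)
    (hq𝔭 : ∀ ⦃T : Over S⦄ (t : T ⟶ A), t ≫ q = 1 → ∀ a ∈ 𝔭, t ≫ α a = 1) [Flat (ker q).hom] :
    Flat (ker φ).hom := by
  haveI := flat_ker_hom_of_pin 𝔭 α ιA ιB hkerA q hq hq𝔭
  obtain ⟨e, -, -⟩ := exists_kerIso_of_comp ιA ιB ιD q d hq hd hφ
  exact flat_hom_of_iso e

end OverScheme

/-! ## §3 Over `Spec R`, affine carriers: the ★ (O-K) ED. 2 instance `Module.Flat R (Γ(G₁) ⧸ J(φ))` -/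

section Affine

open Literature.AlgebraicGeometry.Motives AffineGroupScheme

variable {R : Type u} [CommRing R]

/-- `Γ(Ker φ)` is a flat `R`-module when `Ker φ → Spec R` is flat (★ `flat_alg_of_flat`, ★ `isAffine_ker_left`). [cite: Waterhouse1979, §2.1 p. 14] [cite: EGAIV2, Prop. 2.8.5] -/
theorem flat_alg_ker {G₁ G₂ : SchemeOver R} [GrpObj G₂] [IsAffine G₁.left] [IsAffine G₂.left] (φ : G₁ ⟶ G₂) [Flat (ker φ).hom] :
    Module.Flat R (Alg (ker φ)) := by
  haveI := isAffine_ker_left φ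
  exact flat_alg_of_flat (ker φ)

/-- **`Flat (Ker φ → Spec R) ⇒ Module.Flat R (Γ(G₁) ⧸ J(φ))`**, `J(φ) = φ^*(Γ(G₂)⁺)·Γ(G₁)` — the instance hypothesis of ★ (O-K) ED. 2 `spI_map_ker_counit_pullback_eq`,
from flatness of the kernel SCHEME (★ `ker_appTop_kerι_eq`: `J(φ)` is the ideal of `Ker φ ↪ G₁`; ★ `flat_quotient_ker_comap`). [cite: Waterhouse1979, §2.1 p. 14] [cite: EGAIV2, Prop. 2.8.5] -/
theorem flat_quotient_map_ker_counit_of_flat_ker {G₁ G₂ : SchemeOver R} [GrpObj G₂] [IsAffine G₁.left] [IsAffine G₂.left] (φ : G₁ ⟶ G₂)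
    [Flat (ker φ).hom] :
    Module.Flat R (Alg G₁ ⧸ (RingHom.ker (Bialgebra.counitAlgHom R (Alg G₂))).map (Alg.comap φ)) := by
  haveI := isAffine_ker_left φ
  haveI := isClosedImmersion_kerι_left_of_isAffine φ
  haveI := flat_alg_of_flat (ker φ)
  rw [← ker_appTop_kerι_eq φ]
  exact flat_quotient_ker_comap (kerι φ)

/-- **HEAD — THE ★ (O-K) ED. 2 INSTANCE FOR THE LAYER MAP**: for pins `ιA : A[𝔭] ↪ A` (mono, kernel-of-`𝔭` universal property `hkerA`), `ιB : B[𝔭] ↪ B` (mono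
homomorphism), `ψ : A → B` with `Ker ψ` killed by `𝔭` and `Ker ψ → Spec R` FLAT (e.g. `ψ` the quotient by a flat closed subgroup of `A[𝔭]`), and `φ` the layer map
(`φ ≫ ιB = ιA ≫ ψ`), the `R`-module `Γ(A[𝔭]) ⧸ J(φ)` is FLAT — so ★ `spI_map_ker_counit_pullback_eq` applies to `φ`: the kernel of the special layer map is the
specialisation of the generic one. [cite: Tate1997FiniteFlatGroupSchemes, (3.7) p. 146] [cite: EGAIV2, Prop. 2.8.5] [cite: Waterhouse1979, §2.1 p. 14] -/
theorem flat_quotient_map_ker_counit_of_pin {A B GA GB : SchemeOver R} [MonObj A] [GrpObj B] [GrpObj GB] [IsAffine GA.left] [IsAffine GB.left]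
    {O : Type*} {σ : Type*} [SetLike σ O] (𝔭 : σ) (α : O → (A ⟶ A))
    (ιA : GA ⟶ A) [Mono ιA] (ιB : GB ⟶ B) [IsMonHom ιB] [Mono ιB]
    (hkerA : ∀ ⦃T : SchemeOver R⦄ (t : T ⟶ A), (∀ a ∈ 𝔭, t ≫ α a = 1) ↔ ∃ s : T ⟶ GA, s ≫ ιA = t)
    (ψ : A ⟶ B) {φ : GA ⟶ GB} (hφ : φ ≫ ιB = ιA ≫ ψ)
    (hψ : ∀ ⦃T : SchemeOver R⦄ (t : T ⟶ A), t ≫ ψ = 1 → ∀ a ∈ 𝔭, t ≫ α a = 1) [Flat (ker ψ).hom] :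
    Module.Flat R (Alg GA ⧸ (RingHom.ker (Bialgebra.counitAlgHom R (Alg GB))).map (Alg.comap φ)) := by
  haveI := flat_ker_hom_of_pin 𝔭 α ιA ιB hkerA ψ hφ hψ
  exact flat_quotient_map_ker_counit_of_flat_ker φ

/-- **HEAD (composites) — THE ★ (O-K) ED. 2 INSTANCE FOR THE LAYER MAP OF `q ≫ d`**: `Ker q` killed by `𝔭` with `Ker q → Spec R` flat, the layer map of `d` a
monomorphic homomorphism (a `𝔭`-unit isogeny: `isIso_layerAction_of_mul_add_eq_one` + `isIso_of_isIso_comp_comp`). [cite: Tate1997FiniteFlatGroupSchemes, (3.7) p. 146]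
[cite: EGAIV2, Prop. 2.8.5] -/
theorem flat_quotient_map_ker_counit_of_pin_comp {A B D GA GB GD : SchemeOver R} [MonObj A] [GrpObj B] [GrpObj GB] [GrpObj GD] [IsAffine GA.left] [IsAffine GD.left]
    {O : Type*} {σ : Type*} [SetLike σ O] (𝔭 : σ) (α : O → (A ⟶ A))
    (ιA : GA ⟶ A) [Mono ιA] (ιB : GB ⟶ B) [IsMonHom ιB] [Mono ιB] (ιD : GD ⟶ D) [Mono ιD]
    (hkerA : ∀ ⦃T : SchemeOver R⦄ (t : T ⟶ A), (∀ a ∈ 𝔭, t ≫ α a = 1) ↔ ∃ s : T ⟶ GA, s ≫ ιA = t)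
    (q : A ⟶ B) (d : B ⟶ D) {φq : GA ⟶ GB} (hq : φq ≫ ιB = ιA ≫ q) {φd : GB ⟶ GD} (hd : φd ≫ ιD = ιB ≫ d) [IsMonHom φd] [Mono φd]
    {φ : GA ⟶ GD} (hφ : φ ≫ ιD = ιA ≫ q ≫ d)
    (hq𝔭 : ∀ ⦃T : SchemeOver R⦄ (t : T ⟶ A), t ≫ q = 1 → ∀ a ∈ 𝔭, t ≫ α a = 1) [Flat (ker q).hom] :
    Module.Flat R (Alg GA ⧸ (RingHom.ker (Bialgebra.counitAlgHom R (Alg GD))).map (Alg.comap φ)) := by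
  haveI := flat_ker_hom_of_pin_comp 𝔭 α ιA ιB ιD hkerA q d hq hd hφ hq𝔭
  exact flat_quotient_map_ker_counit_of_flat_ker φ

end Affine

/-! ## §4 Over a Bézout domain (a valuation ring): the schematic image of a flat source is flat -/

section Image

open Literature.AlgebraicGeometry.Motives AffineGroupScheme

variable {R : Type u} [CommRing R] [IsDomain R] [IsBezout R]

/-- **`B ⧸ ker f` IS FLAT WHEN THE TARGET `A` IS** (`f : B →ₐ[R] A`, `R` a Bézout domain — e.g. a valuation ring): `B ⧸ ker f ≅ f.range ≤ A` is torsion-free, and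
torsion-free is flat over a Bézout domain (Mathlib `Module.Flat.flat_iff_torsion_eq_bot_of_isBezout`). [cite: StacksProject, Tag 0539] -/
theorem flat_quotient_ker_of_flat_target {A B : Type*} [CommRing A] [Algebra R A] [CommRing B] [Algebra R B] [Module.Flat R A] (f : B →ₐ[R] A) :
    Module.Flat R (B ⧸ RingHom.ker f) := by
  haveI : Module.Flat R f.range :=
    Module.Flat.flat_iff_torsion_eq_bot_of_isBezout.mpr (Submodule.isTorsionFree_iff_torsion_eq_bot.mp inferInstance)
  exact Module.Flat.of_linearEquiv (Ideal.quotientKerEquivRange f).toLinearEquiv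

/-- **THE SCHEMATIC IMAGE OF A FLAT SOURCE IS FLAT** (scheme dress): for `φ : G₁ ⟶ G₂` of affine `R`-schemes over a Bézout domain `R` (a valuation ring `𝒪_Ω̄`)
with `Γ(G₁)` flat, `Γ(G₂) ⧸ ker Γ(φ)` — the coordinate ring of the schematic image `V(ker Γ(φ)) ↪ G₂` — is `R`-flat; the flatness hypothesis of ★ EGA IV₂ 2.8.5
uniqueness (`IdealClosureGenericFibre`, `FlatClosedSubgroupOfGenericFibre`) for the IMAGE of the layer map. [cite: StacksProject, Tag 0539] [cite: EGAIV2, Prop. 2.8.5] -/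
theorem flat_quotient_ker_comap_of_flat {G₁ G₂ : SchemeOver R} (φ : G₁ ⟶ G₂) [Module.Flat R (Alg G₁)] :
    Module.Flat R (Alg G₂ ⧸ (RingHom.ker (Alg.comap φ).toRingHom : Ideal (Alg G₂))) :=
  flat_quotient_ker_of_flat_target (Alg.comap φ)

end Image

end Literature.AlgebraicGeometry.GroupSchemes.LayerMapKernel

end
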